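import Literature.InformationTheory.QuantumCodes.SmallSetFlipParameterTransfer
import Literature.InformationTheory.QuantumCodes.QuantumExpanderLTZTheorem2
import HarnessLib

/-!
# FGL18 Lemma 24 and Proposition 11 WITHOUT the convention `Δ_A ≤ Δ_B` (min/max constants)

Index of sources: `[cite: FawziGrospellierLeverrier2018]` = Fawzi–Grospellier–Leverrier, "Efficient decoding of
random errors for quantum expander codes", STOC 2018 / arXiv:1711.08351v2 (§3.2 Def 10 / Prop 11, §7.1 Lemma 24);
`[cite: LeverrierTillichZemor2015]` = Leverrier–Tillich–Zémor, FOCS 2015 / arXiv:1504.00822 (§2 conventions).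

qec PARTITION v2 row 04 (`prover-qec-type-04`, gen 4), item 04.FGL1x. The tree proves FGL18 Prop 11 under the
source's standing convention `Δ_A ≤ Δ_B` (`QuantumExpander.FGL18_proposition11_le_holds`; the statement WITHOUT
the convention but WITH the printed constants, `FGL18_proposition11`, is refuted by the `(2,1)` star forest,
`not_FGL18_proposition11`). This file removes the convention by tracking where it is used — in exactly two
inequalities of the proof of Lemma 24 (`d_A‖E‖ ≤ |E| ≤ d_B‖E‖`, and the last step of the function analysis,
`c(Δ_A|x_a| + Δ_B|x_b|) ≥ cΔ_A(|x_a| + |x_b|)`) and in the column-weight bound `|σ_X(e)| ≤ Δ_B|e|` of Prop 11 —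
and replacing `Δ_A`, `Δ_B` there by `min(Δ_A, Δ_B)`, `max(Δ_A, Δ_B)`:

* `hammingNorm_le_wnorm_minmax` — `min(Δ_A,Δ_B)|E| ≤ Δ_AΔ_B‖E‖ ≤ max(Δ_A,Δ_B)|E|` for every `Δ_A, Δ_B`;
* `key_ineq_min` — the arithmetic of Lemma 24 with conclusion `c·min(Δ_A,Δ_B)(|x_a|+|x_b|) ≤ decrease`,
  `c = (1 − 4(δ_A+δ_B+(δ_B−δ_A)²))/2`, derived from the tree's `key_ineq` by the `A ↔ B` symmetry of its hypotheses;
* `exists_smallSet_decrease_minmax` — **Lemma 24 for every biregular expander**: with `r̃ = min/max` and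
  `β̃ = betaZero (min Δ_A Δ_B) (max Δ_A Δ_B) δ_A δ_B = r̃c`, a non-harmless error of weight `≤ r̃·min(γ_A n_A, γ_B n_B)`
  admits a small set with decrease `≥ β̃·max(Δ_A,Δ_B)·|F| = c·min(Δ_A,Δ_B)·|F|`;
* `fgl18_proposition11_minmax` — **Prop 11 for every biregular expander**: every small-set-flip decoder of
  parameter `κ = β̃·max(Δ_A,Δ_B)` corrects every `X`-error of weight `≤ (r̃β̃/(1+β̃))·min(γ_A n_A, γ_B n_B)`; and
  `fgl18_proposition11_minmax_of_le` — the same for every parameter `κ ≤ β̃·max` (Algorithm 1 included), by the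
  tree's Remark 9 (`fgl18_remark9`).

Under the convention (`min = Δ_A`, `max = Δ_B`) these are literally the printed constants (`betaZero_minmax_of_le`);
for `Δ_A > Δ_B` they are OURS (the paper does not state this case; its `X`/`Z` symmetry remark implicitly needs it,
since the `Z`-sector of `G` is the `X`-sector of the reversed graph `Hᵀ`, of degrees `(Δ_B, Δ_A)`). The `(2,1)` star
forest is not a counterexample any more: its radius is `< 1`. All statements PROVED; no definitions, no facts.
-/

namespace Literature.InformationTheory.QuantumCodes

namespace QuantumExpander

open Finset Matrix

variable {A B : Type*} [Fintype A] [Fintype B] [DecidableEq A] [DecidableEq B]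

/-! ### The constants -/

section Constants

/-- `β₀ > 0` is a condition on `δ_A, δ_B` only: for positive degrees,
`betaZero Δ_A Δ_B δ_A δ_B > 0 ↔ 1 − 4(δ_A + δ_B + (δ_B − δ_A)²) > 0` ("`δ_A, δ_B < 1/8` is sufficient to ensure
that `β₀ > 0`"). [cite: FawziGrospellierLeverrier2018, Def 10 (§3.2, arXiv v2 p0011)] -/
theorem betaZero_pos_iff {dA dB : ℕ} (hdA : 0 < dA) (hdB : 0 < dB) (δA δB : ℝ) :
    0 < betaZero dA dB δA δB ↔ 0 < 1 - 4 * (δA + δB + (δB - δA) ^ 2) := by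
  have hr : (0 : ℝ) < (dA : ℝ) / dB / 2 := by positivity
  unfold betaZero
  constructor
  · intro h
    by_contra hneg
    push Not at hneg
    have : (dA : ℝ) / dB / 2 * (1 - 4 * (δA + δB + (δB - δA) ^ 2)) ≤ 0 :=
      mul_nonpos_of_nonneg_of_nonpos hr.le hneg
    linarith
  · intro h
    exact mul_pos hr h

/-- The min/max parameter is positive iff the printed one is (both are a positive multiple of
`1 − 4(δ_A + δ_B + (δ_B − δ_A)²)`). [cite: FawziGrospellierLeverrier2018, Def 10 (§3.2, arXiv v2 p0011)] -/
theorem betaZero_minmax_pos_iff {dA dB : ℕ} (hdA : 0 < dA) (hdB : 0 < dB) (δA δB : ℝ) :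
    0 < betaZero (min dA dB) (max dA dB) δA δB ↔ 0 < betaZero dA dB δA δB := by
  rw [betaZero_pos_iff (lt_min hdA hdB) (lt_max_of_lt_left hdA),
    betaZero_pos_iff hdA hdB]

omit [Fintype A] [Fintype B] [DecidableEq A] [DecidableEq B] in
/-- Under the source's convention `Δ_A ≤ Δ_B` the min/max parameter IS the printed `β₀`.
[cite: FawziGrospellierLeverrier2018, Def 10 (§3.2, arXiv v2 p0011)] -/
theorem betaZero_minmax_of_le {dA dB : ℕ} (hle : dA ≤ dB) (δA δB : ℝ) :
    betaZero (min dA dB) (max dA dB) δA δB = betaZero dA dB δA δB := by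
  rw [min_eq_left hle, max_eq_right hle]

end Constants

/-! ### The two convention-dependent inequalities of Lemma 24, convention-free -/

section ReducedCardinality

omit [DecidableEq A] [DecidableEq B] in
/-- `min(Δ_A,Δ_B)·|E| ≤ Δ_AΔ_B‖E‖ ≤ max(Δ_A,Δ_B)·|E|` for EVERY pair of degrees (the printed
"`d_A‖E‖ ≤ |E| ≤ d_B‖E‖`" is the case `d_A ≤ d_B`). [cite: FawziGrospellierLeverrier2018, Lemma 24 proof eq. (norm prop) (arXiv v2 p0018 L46-48)] -/
theorem hammingNorm_le_wnorm_minmax (dA dB : ℕ) (v : (A × A) ⊕ (B × B) → ZMod 2) :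
    min dA dB * hammingNorm v ≤ wnorm dA dB v ∧ wnorm dA dB v ≤ max dA dB * hammingNorm v := by
  have hsplit : hammingNorm v
      = (univ.filter fun p : A × A => v (Sum.inl p) ≠ 0).card
        + (univ.filter fun p : B × B => v (Sum.inr p) ≠ 0).card := by
    simp only [hammingNorm]
    rw [Finset.card_filter, Finset.card_filter, Finset.card_filter, Fintype.sum_sum_type]
  rw [hsplit, wnorm, mul_add, mul_add]
  constructor
  · exact Nat.add_le_add (Nat.mul_le_mul_right _ (min_le_left _ _))
      (Nat.mul_le_mul_right _ (min_le_right _ _))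
  · exact Nat.add_le_add (Nat.mul_le_mul_right _ (le_max_left _ _))
      (Nat.mul_le_mul_right _ (le_max_right _ _))

/-- **The arithmetic of Lemma 24 without `Δ_A ≤ Δ_B`:** with `X = |x_a|`, `Y = |x_b|`, `za = |χ_a| ≤ 2δ_BΔ_B`,
`zb = |χ_b| ≤ 2δ_AΔ_A`, the minimality constraint `Δ_A X + Δ_B Y ≤ Δ_AΔ_B` and
`c = (1 − 4(δ_A + δ_B + (δ_B − δ_A)²))/2 > 0`, the decrease `X(Δ_A − zb − Y) + (Δ_B − za − X)Y − X zb − za Y` is at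
least `c·min(Δ_A,Δ_B)·(X + Y)`. (The tree's `key_ineq` is the case `Δ_A ≤ Δ_B`, where `c·Δ_A = β₀Δ_B`; the case
`Δ_A ≥ Δ_B` is the same inequality with the roles of `A` and `B` exchanged — its hypotheses and its right-hand
side are symmetric.) [cite: FawziGrospellierLeverrier2018, Lemma 24 proof (arXiv v2 p0018 L72-130) with Def 10] -/
theorem key_ineq_min {dA dB X Y za zb δA δB : ℝ} (hdA : 0 < dA) (hdB : 0 < dB) (hX : 0 ≤ X) (hY : 0 ≤ Y)
    (hza : za ≤ 2 * δB * dB) (hzb : zb ≤ 2 * δA * dA) (hmin : dA * X + dB * Y ≤ dA * dB)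
    (hc : 0 < 1 - 4 * (δA + δB + (δB - δA) ^ 2)) :
    (1 - 4 * (δA + δB + (δB - δA) ^ 2)) / 2 * min dA dB * (X + Y)
      ≤ X * (dA - zb - Y) + (dB - za - X) * Y - X * zb - za * Y := by
  rcases le_total dA dB with hle | hle
  · have hβ : 0 < (dA / dB) / 2 * (1 - 4 * (δA + δB + (δB - δA) ^ 2)) :=
      mul_pos (by positivity) hc
    have h := key_ineq hdA hle hX hY hza hzb hmin hβ
    have e1 : (dA / dB) / 2 * (1 - 4 * (δA + δB + (δB - δA) ^ 2)) * dB * (X + Y)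
        = (1 - 4 * (δA + δB + (δB - δA) ^ 2)) / 2 * dA * (X + Y) := by
      field_simp
    rw [min_eq_left hle, ← e1]
    exact h
  · have hmin' : dB * Y + dA * X ≤ dB * dA := by linarith
    have hc' : 0 < 1 - 4 * (δB + δA + (δA - δB) ^ 2) := by
      have : (δA - δB) ^ 2 = (δB - δA) ^ 2 := by ring
      rw [add_comm δB δA, this]; exact hc
    have hβ : 0 < (dB / dA) / 2 * (1 - 4 * (δB + δA + (δA - δB) ^ 2)) :=
      mul_pos (by positivity) hc'
    have h := key_ineq hdB hle hY hX hzb hza hmin' hβ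
    have e1 : (dB / dA) / 2 * (1 - 4 * (δB + δA + (δA - δB) ^ 2)) * dA * (Y + X)
        = (1 - 4 * (δA + δB + (δB - δA) ^ 2)) / 2 * dB * (X + Y) := by
      field_simp
      ring
    have e2 : Y * (dB - za - X) + (dA - zb - Y) * X - Y * za - zb * X
        = X * (dA - zb - Y) + (dB - za - X) * Y - X * zb - za * Y := by ring
    rw [min_eq_right hle, ← e1, ← e2]
    exact h

end ReducedCardinality

/-! ### Lemma 24 for every biregular expander -/

section Lemma24

/-- **FGL18 Lemma 24 WITHOUT the convention `Δ_A ≤ Δ_B`, PROVED**: for a `(Δ_A, Δ_B)`-biregular (`Δ ≥ 1`)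
`(γ_A, δ_A, γ_B, δ_B)`-expanding `G` with `β̃ = betaZero (min Δ_A Δ_B) (max Δ_A Δ_B) δ_A δ_B > 0` and an error `e`
that is NOT harmless with `|e| ≤ (min/max)·min(γ_A n_A, γ_B n_B)`, some small set `F ∈ 𝓕` has
`|σ_X(e)| − |σ_X(e ⊕ F)| ≥ β̃·max(Δ_A,Δ_B)·|F|`. Proof = the printed one (as in the tree's
`exists_smallSet_decrease`) with the two convention-free inequalities above: the `‖·‖`-minimal representative has
`min·|E_R| ≤ Δ_AΔ_B‖E_R‖ ≤ Δ_AΔ_B‖e‖ ≤ max·|e| ≤ min·min(γ_A n_A, γ_B n_B)`, a critical generator exists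
(LTZ15 Lemma 7), and `key_ineq_min` bounds the decrease of its flip.
[cite: FawziGrospellierLeverrier2018, Lemma 24 (§7.1, arXiv v2 p0018 L36-130)] [cite: LeverrierTillichZemor2015, Lemma 8 (arXiv v1 p0008 L104-110)] -/
theorem exists_smallSet_decrease_minmax (H : Matrix B A (ZMod 2)) {dA dB : ℕ} {γA δA γB δB : ℝ}
    (hreg : IsBiregular H dA dB) (hexp : IsLeftRightExpanding H dA dB γA δA γB δB)
    (hdA : 0 < dA) (hdB : 0 < dB) (hδA : 0 < δA) (hδB : 0 < δB)
    (hβ : 0 < betaZero (min dA dB) (max dA dB) δA δB)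
    (e : (A × A) ⊕ (B × B) → ZMod 2) (he : e ∉ rowSpace (expanderHZ H))
    (hw : (hammingNorm e : ℝ)
      ≤ ((min dA dB : ℕ) : ℝ) / ((max dA dB : ℕ) : ℝ) * min (γA * Fintype.card A) (γB * Fintype.card B)) :
    ∃ F ∈ smallSets (expanderHZ H),
      betaZero (min dA dB) (max dA dB) δA δB * ((max dA dB : ℕ) : ℝ) * F.card
        ≤ (syndromeDecrease (expanderHX H) (expanderHX H *ᵥ e) F : ℝ) := by
  classical
  -- the weighted-size-minimal representative of the coset
  obtain ⟨eR, heR, hmin⟩ := exists_wnorm_min (expanderHZ H) (wnorm dA dB) e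
  have hsyn : expanderHX H *ᵥ eR = expanderHX H *ᵥ e := by
    have h0 := expanderHX_mulVec_eq_zero_of_mem_rowSpace H heR
    rw [Matrix.mulVec_sub, sub_eq_zero] at h0
    exact h0
  have heR_not : eR ∉ rowSpace (expanderHZ H) := by
    intro h
    apply he
    have : e = eR - (eR - e) := by abel
    rw [this]
    exact Submodule.sub_mem _ h heR
  have heR0 : (supp eR).Nonempty := by
    by_contra h0
    rw [Finset.not_nonempty_iff_eq_empty] at h0
    apply heR_not
    have hz : eR = 0 := by
      ext q
      by_contra hq
      have : q ∈ supp eR := by simpa [supp] using hq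
      rw [h0] at this
      exact Finset.notMem_empty _ this
    rw [hz]; exact Submodule.zero_mem _
  -- `|E_R| ≤ min(γ_A n_A, γ_B n_B)`
  set dm : ℕ := min dA dB with hdm
  set dM : ℕ := max dA dB with hdM
  have hdm0 : 0 < dm := lt_min hdA hdB
  have hdM0 : 0 < dM := lt_max_of_lt_left hdA
  have hdm' : (0 : ℝ) < dm := by exact_mod_cast hdm0
  have hdM' : (0 : ℝ) < dM := by exact_mod_cast hdM0
  have hcardR : ((supp eR).card : ℝ) ≤ min (γA * Fintype.card A) (γB * Fintype.card B) := by
    have h1 : dm * hammingNorm eR ≤ wnorm dA dB eR := (hammingNorm_le_wnorm_minmax dA dB eR).1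
    have h2 : wnorm dA dB eR ≤ wnorm dA dB e := hmin e (by simp)
    have h3 : wnorm dA dB e ≤ dM * hammingNorm e := (hammingNorm_le_wnorm_minmax dA dB e).2
    have h4 : ((dm : ℝ) * hammingNorm eR) ≤ dM * hammingNorm e := by
      exact_mod_cast h1.trans (h2.trans h3)
    have hsupp : (supp eR).card = hammingNorm eR := by simp [supp, hammingNorm]
    rw [hsupp]
    have h5 : (dM : ℝ) * hammingNorm e ≤ dm * min (γA * Fintype.card A) (γB * Fintype.card B) := by
      have h6 := mul_le_mul_of_nonneg_left hw hdM'.le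
      have h7 : (dM : ℝ) * ((dm : ℝ) / dM * min (γA * Fintype.card A) (γB * Fintype.card B))
          = dm * min (γA * Fintype.card A) (γB * Fintype.card B) := by
        field_simp
      linarith
    have h8 : (dm : ℝ) * hammingNorm eR ≤ dm * min (γA * Fintype.card A) (γB * Fintype.card B) :=
      h4.trans h5
    exact le_of_mul_le_mul_left h8 hdm'
  have hcardA : ((supp eR).card : ℝ) ≤ γA * Fintype.card A := hcardR.trans (min_le_left _ _)
  have hcardB : ((supp eR).card : ℝ) ≤ γB * Fintype.card B := hcardR.trans (min_le_right _ _)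
  -- a critical generator for `E_R`, and its flip set
  obtain ⟨b, a, Χa, Χb, hc⟩ :=
    exists_isCritical H hreg hexp hdA hdB hδA.le hδB.le (supp eR) heR0 hcardA hcardB
  refine ⟨critFlip H eR b a Χa Χb, critFlip_mem_smallSets hc, ?_⟩
  have hdec := syndromeDecrease_critFlip_ge hreg hc
  rw [hsyn] at hdec
  -- minimality of `E_R` against `E_R ⊕ g_{ba}`
  have hmin' : dA * (critX H eR b a Χa).card + dB * (critY H eR b a Χb).card ≤ dA * dB := by
    have hrow := wnorm_add_row H hreg eR b a
    have hle' : wnorm dA dB eR ≤ wnorm dA dB (eR + expanderHZ H (b, a)) := by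
      refine hmin _ ?_
      have : eR + expanderHZ H (b, a) - e = (eR - e) + expanderHZ H (b, a) := by abel
      rw [this]
      exact Submodule.add_mem _ heR (expanderHZ_row_mem_rowSpace H b a)
    have hXle : (critX H eR b a Χa).card
        ≤ ((nbrs Hᵀ b).filter fun α => eR (Sum.inl (α, a)) ≠ 0).card := by
      refine Finset.card_le_card fun α hα => ?_
      rw [mem_critX] at hα
      rw [Finset.mem_filter, mem_nbrs, Matrix.transpose_apply]
      exact ⟨hα.1.1, hα.2⟩
    have hYle : (critY H eR b a Χb).card
        ≤ ((nbrs H a).filter fun β => eR (Sum.inr (b, β)) ≠ 0).card := by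
      refine Finset.card_le_card fun β hβ => ?_
      rw [mem_critY] at hβ
      rw [Finset.mem_filter, mem_nbrs]
      exact ⟨hβ.1.1, hβ.2⟩
    have hX' := Nat.mul_le_mul_left dA hXle
    have hY' := Nat.mul_le_mul_left dB hYle
    linarith
  -- the arithmetic
  have hF : ((critFlip H eR b a Χa Χb).card : ℝ)
      = (critX H eR b a Χa).card + (critY H eR b a Χb).card := by
    exact_mod_cast card_critFlip H eR b a Χa Χb
  rw [hF]
  have hdA' : (0 : ℝ) < dA := by exact_mod_cast hdA
  have hdB' : (0 : ℝ) < dB := by exact_mod_cast hdB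
  have hcpos : 0 < 1 - 4 * (δA + δB + (δB - δA) ^ 2) :=
    (betaZero_pos_iff hdm0 hdM0 δA δB).1 hβ
  have hkey := key_ineq_min (X := ((critX H eR b a Χa).card : ℝ)) (Y := ((critY H eR b a Χb).card : ℝ))
    (za := (Χa.card : ℝ)) (zb := (Χb.card : ℝ)) hdA' hdB' (Nat.cast_nonneg _)
    (Nat.cast_nonneg _) hc.card_Χa_le hc.card_Χb_le (by exact_mod_cast hmin') hcpos
  have hdecR : ((critX H eR b a Χa).card : ℝ) * ((dA : ℝ) - Χb.card - (critY H eR b a Χb).card)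
      + ((dB : ℝ) - Χa.card - (critX H eR b a Χa).card) * (critY H eR b a Χb).card
      - (critX H eR b a Χa).card * Χb.card - Χa.card * (critY H eR b a Χb).card
      ≤ (syndromeDecrease (expanderHX H) (expanderHX H *ᵥ e) (critFlip H eR b a Χa Χb) : ℝ) := by
    exact_mod_cast hdec
  -- `β̃ · max = c · min`
  have hβc : betaZero dm dM δA δB * (dM : ℝ)
      = (1 - 4 * (δA + δB + (δB - δA) ^ 2)) / 2 * min (dA : ℝ) (dB : ℝ) := by
    have hmincast : (min (dA : ℝ) (dB : ℝ)) = ((dm : ℕ) : ℝ) := by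
      rw [hdm, Nat.cast_min]
    rw [hmincast]
    unfold betaZero
    field_simp
  rw [hβc]
  linarith

end Lemma24

/-! ### Proposition 11 for every biregular expander -/

section Proposition11

/-- **FGL18 Proposition 11 WITHOUT the convention `Δ_A ≤ Δ_B`, PROVED**: for a `(Δ_A, Δ_B)`-biregular (`Δ ≥ 1`)
`(γ_A, δ_A, γ_B, δ_B)`-left-right-expanding graph with `β̃ = betaZero (min Δ_A Δ_B) (max Δ_A Δ_B) δ_A δ_B > 0`
(equivalently `β₀ > 0`), EVERY small-set-flip decoder with parameter `κ = β̃·max(Δ_A,Δ_B)` (any tie-breaking)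
corrects EVERY `X`-error of weight `≤ (r̃β̃/(1+β̃))·min(γ_A n_A, γ_B n_B)`, `r̃ = min(Δ_A,Δ_B)/max(Δ_A,Δ_B)`. Under
the convention these are the printed parameter `β₀Δ_B` and radius `(rβ₀/(1+β₀))·min(γ_A n_A, γ_B n_B)`. Proof as
printed, with `|σ_X(e)| ≤ max(Δ_A,Δ_B)|e|` (`hammingNorm_expanderHX_mulVec_le_max`) and Lemma 24 in the form
`exists_smallSet_decrease_minmax`: along the run `κΣ|Fᵢ| ≤ |σ₀| ≤ max·|e|`, so `|E_f| ≤ |e|(1+β̃)/β̃ ≤ r̃·min`; a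
non-harmless final error would admit a small set passing the while-condition at the HALTING syndrome.
[cite: FawziGrospellierLeverrier2018, Prop 11 (§3.2, arXiv v2 p0011) and its proof (§7.1, p0018 L131-p0019 L6)] -/
theorem fgl18_proposition11_minmax (H : Matrix B A (ZMod 2)) {dA dB : ℕ} {γA δA γB δB : ℝ}
    (hreg : IsBiregular H dA dB) (hexp : IsLeftRightExpanding H dA dB γA δA γB δB)
    (hdA : 0 < dA) (hdB : 0 < dB) (hδA : 0 < δA) (hδB : 0 < δB)
    (hβ : 0 < betaZero (min dA dB) (max dA dB) δA δB)
    (D : Decoder (A × B → ZMod 2) ((A × A) ⊕ (B × B) → ZMod 2))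
    (hD : IsSSFDecoder (betaZero (min dA dB) (max dA dB) δA δB * ((max dA dB : ℕ) : ℝ))
      (expanderHX H) (expanderHZ H) D)
    (e : (A × A) ⊕ (B × B) → ZMod 2)
    (he : (hammingNorm e : ℝ) ≤
      ((min dA dB : ℕ) : ℝ) / ((max dA dB : ℕ) : ℝ) * betaZero (min dA dB) (max dA dB) δA δB
        / (1 + betaZero (min dA dB) (max dA dB) δA δB) * min (γA * Fintype.card A) (γB * Fintype.card B)) :
    D.Corrects (fun x => expanderHX H *ᵥ x)
      (rowSpace (expanderHZ H) : Set ((A × A) ⊕ (B × B) → ZMod 2)) e := by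
  classical
  set dM : ℕ := max dA dB with hdM
  set β : ℝ := betaZero (min dA dB) (max dA dB) δA δB with hβdef
  set κ : ℝ := β * dM with hκ
  obtain ⟨l, hrun, hDσ⟩ := hD (expanderHX H *ᵥ e)
  obtain ⟨hhalt, hsum⟩ := ssfRun_invariants hrun
  rw [Decoder.Corrects, hDσ]
  by_contra hnot
  have hnot' : runOutput l + e ∉ rowSpace (expanderHZ H) := fun h => hnot (SetLike.mem_coe.2 h)
  -- positivity facts
  have hdM0 : 0 < dM := lt_max_of_lt_left hdA
  have hdM' : (0 : ℝ) < dM := by exact_mod_cast hdM0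
  have hκ0 : 0 < κ := by rw [hκ]; exact mul_pos hβ hdM'
  -- the flips are paid for by the initial syndrome weight `≤ max(Δ_A,Δ_B) |e|`
  have hσ0 : (hammingNorm (expanderHX H *ᵥ e) : ℝ) ≤ dM * hammingNorm e := by
    rw [hdM]; exact_mod_cast hammingNorm_expanderHX_mulVec_le_max H hreg e
  have hflips : κ * ((l.map Finset.card).sum : ℝ) ≤ dM * hammingNorm e := by
    have h0 : (0 : ℝ) ≤ hammingNorm (expanderHX H *ᵥ e + expanderHX H *ᵥ runOutput l) := Nat.cast_nonneg _
    linarith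
  have hsubadd : (hammingNorm (runOutput l + e) : ℝ) ≤ hammingNorm (runOutput l) + hammingNorm e := by
    have h := hammingDist_triangle (runOutput l + e) e 0
    have h1 : hammingDist (runOutput l + e) e = hammingNorm (runOutput l) := by
      rw [hammingDist_comm, hammingDist_eq_hammingNorm]
      congr 1; ext i; simp only [Pi.add_apply, Pi.neg_apply]; ring
    rw [hammingDist_zero_right, hammingDist_zero_right, h1] at h
    exact_mod_cast h
  -- weight of the final error `E_f = e ⊕ Ê`
  have hEf : (hammingNorm (runOutput l + e) : ℝ)
      ≤ ((min dA dB : ℕ) : ℝ) / (dM : ℝ) * min (γA * Fintype.card A) (γB * Fintype.card B) := by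
    have h2 : (hammingNorm (runOutput l) : ℝ) ≤ (l.map Finset.card).sum := by
      exact_mod_cast hammingNorm_runOutput_le l
    -- `Σ|F_i| ≤ |e|/β̃`
    have h3 : ((l.map Finset.card).sum : ℝ) ≤ hammingNorm e / β := by
      rw [le_div_iff₀ hβ]
      have : κ * ((l.map Finset.card).sum : ℝ) = β * dM * (l.map Finset.card).sum := by rw [hκ]
      nlinarith
    -- `|e| (1 + 1/β̃) ≤ r̃·min`
    have h4 : (hammingNorm e : ℝ) + hammingNorm e / β
        ≤ ((min dA dB : ℕ) : ℝ) / (dM : ℝ) * min (γA * Fintype.card A) (γB * Fintype.card B) := by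
      set M := ((min dA dB : ℕ) : ℝ) / (dM : ℝ) * min (γA * Fintype.card A) (γB * Fintype.card B) with hM
      have he' : (hammingNorm e : ℝ) ≤ β / (1 + β) * M := by
        rw [hM]
        calc (hammingNorm e : ℝ)
            ≤ ((min dA dB : ℕ) : ℝ) / (dM : ℝ) * β / (1 + β) * min (γA * Fintype.card A) (γB * Fintype.card B) := he
          _ = β / (1 + β) * (((min dA dB : ℕ) : ℝ) / (dM : ℝ) * min (γA * Fintype.card A) (γB * Fintype.card B)) := by
              ring
      have h1b : 0 < 1 + β := by linarith
      have hkey : (hammingNorm e : ℝ) * (1 + β) ≤ β * M := by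
        have h := he'
        rw [div_mul_eq_mul_div, le_div_iff₀ h1b] at h
        exact h
      have hrew : (hammingNorm e : ℝ) + hammingNorm e / β = hammingNorm e * (1 + β) / β := by
        field_simp
        ring
      rw [hrew, div_le_iff₀ hβ]
      linarith
    linarith
  -- Lemma 24 at the final error: a small set passing the while-condition at the halting syndrome
  obtain ⟨F, hF, hFdec⟩ := exists_smallSet_decrease_minmax H hreg hexp hdA hdB hδA hδB hβ
    (runOutput l + e) hnot' hEf
  have hsynf : expanderHX H *ᵥ (runOutput l + e) = expanderHX H *ᵥ e + expanderHX H *ᵥ runOutput l := by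
    rw [Matrix.mulVec_add, add_comm]
  rw [hsynf] at hFdec
  have hFpos : (0 : ℝ) < F.card := by exact_mod_cast card_pos_of_mem_smallSets hF
  have hFdec' : κ * F.card
      ≤ (syndromeDecrease (expanderHX H) (expanderHX H *ᵥ e + expanderHX H *ᵥ runOutput l) F : ℝ) := by
    rw [hκ, hβdef, hdM]; exact hFdec
  have hdecpos : 0 < syndromeDecrease (expanderHX H) (expanderHX H *ᵥ e + expanderHX H *ᵥ runOutput l) F := by
    have : (0 : ℝ) < syndromeDecrease (expanderHX H) (expanderHX H *ᵥ e + expanderHX H *ᵥ runOutput l) F :=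
      lt_of_lt_of_le (mul_pos hκ0 hFpos) hFdec'
    exact_mod_cast this
  exact hhalt F hF ⟨hdecpos, hFdec'⟩

/-- **Proposition 11 without the convention, for every parameter `κ ≤ β̃·max(Δ_A,Δ_B)`** — in particular for
Algorithm 1 (`κ = 0`, LTZ15's decoder): Remark 9 (`fgl18_remark9`, proved in
`SmallSetFlipParameterTransfer.lean`) applied to `fgl18_proposition11_minmax`.
[cite: FawziGrospellierLeverrier2018, Prop 11 with Remark 9 (§3.2, arXiv v2 p0011)] -/
theorem fgl18_proposition11_minmax_of_le (H : Matrix B A (ZMod 2)) {dA dB : ℕ} {γA δA γB δB : ℝ}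
    (hreg : IsBiregular H dA dB) (hexp : IsLeftRightExpanding H dA dB γA δA γB δB)
    (hdA : 0 < dA) (hdB : 0 < dB) (hδA : 0 < δA) (hδB : 0 < δB)
    (hβ : 0 < betaZero (min dA dB) (max dA dB) δA δB)
    {κ : ℝ} (hκ : κ ≤ betaZero (min dA dB) (max dA dB) δA δB * ((max dA dB : ℕ) : ℝ))
    {D : Decoder (A × B → ZMod 2) ((A × A) ⊕ (B × B) → ZMod 2)}
    (hD : IsSSFDecoder κ (expanderHX H) (expanderHZ H) D)
    {e : (A × A) ⊕ (B × B) → ZMod 2}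
    (he : (hammingNorm e : ℝ) ≤
      ((min dA dB : ℕ) : ℝ) / ((max dA dB : ℕ) : ℝ) * betaZero (min dA dB) (max dA dB) δA δB
        / (1 + betaZero (min dA dB) (max dA dB) δA δB) * min (γA * Fintype.card A) (γB * Fintype.card B)) :
    D.Corrects (fun x => expanderHX H *ᵥ x)
      (rowSpace (expanderHZ H) : Set ((A × A) ⊕ (B × B) → ZMod 2)) e :=
  fgl18_remark9 H hκ e (fun D' hD' => fgl18_proposition11_minmax H hreg hexp hdA hdB hδA hδB hβ D' hD' e he) hD

end Proposition11

end QuantumExpander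

end Literature.InformationTheory.QuantumCodes
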